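import Literature.Analysis.InnerProduct.HilbertComplexLaplacianClosedRange
import Literature.Analysis.InnerProduct.HilbertComplexGreenOperator
import Mathlib.Analysis.Normed.Operator.Compact.Basic
import HarnessLib

/-!
# The compactness property of a Hilbert complex: a compact embedding of `D_{T*} ∩ D_S` (graph norm) into
# `H₂` gives Hörmander's compactness hypothesis, hence `dim 𝔥 < ∞`, the basic estimate, closed ranges of
# `T`, `S`, `□`, the strong Hodge decomposition, and a COMPACT Green operator
# (Arnold–Falk–Winther 2010 §3.1 "compactness property ⟹ Fredholm ⟹ closed", §3.5; Hörmander 1965 Thm 1.1.3)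

Layer `Literature/Analysis/InnerProduct`, namespace `Literature.Analysis.InnerProduct`; sequel BY NAME of
`HilbertComplexBasicEstimate.lean` (row g31-#7: Hörmander's Theorem 1.1.3 `finiteDimensional_harmonic_of_seqCompact`,
`exists_basic_estimate_of_seqCompact`, `isClosed_range_of_seqCompact`, and Theorem 1.1.2), of
`HilbertComplexLaplacianClosedRange.lean` (row g31-#10: `isClosed_range_laplacian_of_basic_estimate`,
`norm_le_of_basic_estimate`) and of `HilbertComplexGreenOperator.lean` (row g31-#9: the bounds
`norm_green_le_of_basic_estimate`, `norm_adjoint_green_le_of_basic_estimate`, `norm_apply_green_le_of_basic_estimate`).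
Lane `lit-hodgefound` (Track 2 foundations library), prover seat `lit-hodgefound-p06` (generation 31),
self-proposed row g31-#11. THEOREMS ONLY (no definition, no named fact). The "compactness property" is taken as
DATA, in the form in which Rellich-type theorems deliver it: a normed space `Q`, a compact bounded linear map
`ι : Q →L[𝕜] F` whose range contains `D_{T*} ∩ D_S`, and a constant `M` with
`‖q‖_Q ≤ M (‖ιq‖ + ‖T*ιq‖ + ‖Sιq‖)` whenever `ιq ∈ D_{T*} ∩ D_S` (for AFW's `Q = V ∩ V*` with its graph norm and
`ι` the inclusion this holds with `M = 1`).

## Sources, verbatim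

D. N. Arnold, R. S. Falk, R. Winther, Bull. AMS 47 (2010), end of §3.1 (held text `paper:arxiv-0906.4325`,
p0015): "the intersection `V^k ∩ V*_k` is a Hilbert space with the norm
`‖v‖²_{V∩V*} = ‖v‖²_V + ‖v‖²_{V*} = 2‖v‖²_W + ‖d^k v‖²_W + ‖d*_k v‖²_W`, and is continuously included in `W^k`. We
say that the Hilbert complex `(W, d)` has the compactness property if `V^k ∩ V*_k` is dense in `W^k` and the
inclusion is a compact operator. Restricted to the space `𝔥^k` of harmonic forms, the `V^k ∩ V*_k` norm is equal
to the `W^k` norm (times `√2`). Therefore the compactness property implies that the inclusion of `𝔥^k` into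
itself is compact, so `𝔥^k` is finite dimensional. In summary, for Hilbert complexes,
compactness property ⟹ Fredholm ⟹ closed." And §3.5 (p0021): "`K` maps `W^k` boundedly into `V^k ∩ V*_k` …
Hence `K` is a compact operator `W^k → V^k ∩ V*_k` and, a fortiori, compact as an operator from `W^k` to itself."

L. Hörmander, Acta Math. 113 (1965), §1.1 (p0005): "Sufficient conditions for (1.1.4) can be obtained by
compactness arguments: THEOREM 1.1.3. Assume that from every sequence `g_k ∈ D_{T*} ∩ D_S` with `‖g_k‖₂` bounded
and `T*g_k → 0` in `H₁`, `Sg_k → 0` in `H₃`, one can select a strongly convergent subsequence. Then (1.1.4) holds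
and `N` is finite dimensional."

## What is proved (all over `𝕜 = ℝ` or `ℂ`)

* **`seqCompact_of_isCompactOperator`** — the compactness property gives the hypothesis of Hörmander's Theorem
  1.1.3 (a bounded sequence with `T*g_k → 0`, `Sg_k → 0` is bounded in the graph norm, so its `ι`-preimages are
  bounded in `Q` and `ι` maps them into a compact set);
* hence **`finiteDimensional_harmonic_of_isCompactOperator`** (`dim 𝔥 < ∞`),
  **`exists_basic_estimate_of_isCompactOperator`** ((1.1.4)), **`isClosed_range_of_isCompactOperator`** (`Im T`,
  `Im S` closed — "compactness property ⟹ Fredholm ⟹ closed"), `isClosed_range_laplacian_of_isCompactOperator`,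
  `exists_gap_of_isCompactOperator` (`‖u‖ ≤ c‖□u‖` on `D_□ ∩ 𝔥^⊥`),
  `harmonic_sup_range_sup_range_adjoint_eq_top_of_isCompactOperator` (`H₂ = 𝔥 ⊕ Im T ⊕ Im S*`);
* **`isCompactOperator_green`** — a Green operator `K` (row g31-#9) is a compact operator on `H₂` ("`K` maps `W`
  boundedly into `V ∩ V*` … Hence `K` is a compact operator").

## References

* [ArnoldFalkWinther2010] D. N. Arnold, R. S. Falk, R. Winther, *Finite element exterior calculus: from Hodge
  theory to numerical stability*, Bull. AMS 47 (2010), §3.1 (compactness property ⟹ Fredholm ⟹ closed), §3.5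
  (`K` compact).
* [Hormander1965] L. Hörmander, *L² estimates and existence theorems for the ∂̄ operator*, Acta Math. 113
  (1965), §1.1 Thm 1.1.3.
* [BruningLesch1992] J. Brüning, M. Lesch, *Hilbert complexes*, J. Funct. Anal. 108 (1992), §2 Thm 2.4,
  Cor. 2.5 (Fredholm complexes, strong Hodge decomposition).
-/

noncomputable section

open scoped InnerProductSpace LinearPMap
open Filter Topology

namespace Literature.Analysis.InnerProduct

variable {𝕜 E F G : Type*} [RCLike 𝕜]
variable [NormedAddCommGroup E] [InnerProductSpace 𝕜 E] [CompleteSpace E]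
variable [NormedAddCommGroup F] [InnerProductSpace 𝕜 F] [CompleteSpace F]
variable [NormedAddCommGroup G] [InnerProductSpace 𝕜 G] [CompleteSpace G]
variable {Q : Type*} [NormedAddCommGroup Q] [NormedSpace 𝕜 Q]
variable {T : E →ₗ.[𝕜] F} {S : F →ₗ.[𝕜] G} {L : F →ₗ.[𝕜] F} {K : F →L[𝕜] F}

omit [CompleteSpace F] [CompleteSpace G] in
/-- The `ι`-preimage bound: if `ιq ∈ D_{T*} ∩ D_S` and the three graph-norm terms are bounded, `q` lies in a
fixed closed ball of `Q`. [folklore] -/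
private theorem norm_le_of_graph_bound {ι : Q →L[𝕜] F} {M : ℝ}
    (hιnorm : ∀ (q : Q) (h₁ : ι q ∈ T†.domain) (h₂ : ι q ∈ S.domain),
      ‖q‖ ≤ M * (‖ι q‖ + ‖T† ⟨ι q, h₁⟩‖ + ‖S ⟨ι q, h₂⟩‖))
    {q : Q} (h₁ : ι q ∈ T†.domain) (h₂ : ι q ∈ S.domain) {a b c : ℝ} (ha : ‖ι q‖ ≤ a)
    (hb : ‖T† ⟨ι q, h₁⟩‖ ≤ b) (hc : ‖S ⟨ι q, h₂⟩‖ ≤ c) : ‖q‖ ≤ max M 0 * (a + b + c) := by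
  have hs : 0 ≤ ‖ι q‖ + ‖T† ⟨ι q, h₁⟩‖ + ‖S ⟨ι q, h₂⟩‖ := by positivity
  calc ‖q‖ ≤ M * (‖ι q‖ + ‖T† ⟨ι q, h₁⟩‖ + ‖S ⟨ι q, h₂⟩‖) := hιnorm q h₁ h₂
    _ ≤ max M 0 * (‖ι q‖ + ‖T† ⟨ι q, h₁⟩‖ + ‖S ⟨ι q, h₂⟩‖) := mul_le_mul_of_nonneg_right (le_max_left _ _) hs
    _ ≤ max M 0 * (a + b + c) := by gcongr

omit [CompleteSpace F] [CompleteSpace G] in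
/-- **The compactness property gives Hörmander's compactness hypothesis (Theorem 1.1.3)**: from every sequence
`g_k ∈ D_{T*} ∩ D_S` with `‖g_k‖` bounded and `T*g_k → 0`, `Sg_k → 0` one can select a strongly convergent
subsequence (the `ι`-preimages are bounded in `Q`, and `ι` is compact). [cite: ArnoldFalkWinther2010, §3.1
("compactness property ⟹ Fredholm"); Hormander1965, §1.1 Thm 1.1.3 (hypothesis)] -/
theorem seqCompact_of_isCompactOperator (ι : Q →L[𝕜] F) (hι : IsCompactOperator ι)
    (hιsurj : ∀ g : F, g ∈ T†.domain → g ∈ S.domain → ∃ q : Q, ι q = g) {M : ℝ}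
    (hιnorm : ∀ (q : Q) (h₁ : ι q ∈ T†.domain) (h₂ : ι q ∈ S.domain),
      ‖q‖ ≤ M * (‖ι q‖ + ‖T† ⟨ι q, h₁⟩‖ + ‖S ⟨ι q, h₂⟩‖)) :
    ∀ (g : ℕ → F) (hgT : ∀ k, g k ∈ T†.domain) (hgS : ∀ k, g k ∈ S.domain),
      (∃ M : ℝ, ∀ k, ‖g k‖ ≤ M) → Tendsto (fun k ↦ T† ⟨g k, hgT k⟩) atTop (𝓝 0) →
      Tendsto (fun k ↦ S ⟨g k, hgS k⟩) atTop (𝓝 0) →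
      ∃ g₀ : F, ∃ φ : ℕ → ℕ, StrictMono φ ∧ Tendsto (g ∘ φ) atTop (𝓝 g₀) := by
  intro g hgT hgS hB hT hS
  obtain ⟨B, hB⟩ := hB
  obtain ⟨BT, hBT⟩ := hT.norm.bddAbove_range
  obtain ⟨BS, hBS⟩ := hS.norm.bddAbove_range
  choose q hq using fun k ↦ hιsurj (g k) (hgT k) (hgS k)
  set R : ℝ := max M 0 * (B + BT + BS) with hR
  have hmem : ∀ k, g k ∈ closure ((ι : Q → F) '' Metric.closedBall 0 R) := by
    intro k
    refine subset_closure ⟨q k, ?_, hq k⟩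
    rw [mem_closedBall_zero_iff]
    have h₁ : ι (q k) ∈ T†.domain := by rw [hq k]; exact hgT k
    have h₂ : ι (q k) ∈ S.domain := by rw [hq k]; exact hgS k
    refine norm_le_of_graph_bound hιnorm h₁ h₂ ?_ ?_ ?_
    · rw [hq k]; exact hB k
    · have e : T† ⟨ι (q k), h₁⟩ = T† ⟨g k, hgT k⟩ := by congr 1; exact Subtype.ext (hq k)
      rw [e]; exact hBT (Set.mem_range_self k)
    · have e : S ⟨ι (q k), h₂⟩ = S ⟨g k, hgS k⟩ := by congr 1; exact Subtype.ext (hq k)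
      rw [e]; exact hBS (Set.mem_range_self k)
  have hcpt : IsCompact (closure ((ι : Q → F) '' Metric.closedBall 0 R)) :=
    hι.isCompact_closure_image_closedBall (f := (ι : Q →ₗ[𝕜] F)) R
  obtain ⟨g₀, -, φ, hφ, hlim⟩ := hcpt.tendsto_subseq hmem
  exact ⟨g₀, φ, hφ, hlim⟩

omit [CompleteSpace F] [CompleteSpace G] in
/-- **"the compactness property implies that … `𝔥` is finite dimensional".** [cite: ArnoldFalkWinther2010, §3.1;
Hormander1965, §1.1 Thm 1.1.3] -/
theorem finiteDimensional_harmonic_of_isCompactOperator (hdT : Dense (T.domain : Set E)) (hcS : S.IsClosed)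
    (ι : Q →L[𝕜] F) (hι : IsCompactOperator ι)
    (hιsurj : ∀ g : F, g ∈ T†.domain → g ∈ S.domain → ∃ q : Q, ι q = g) {M : ℝ}
    (hιnorm : ∀ (q : Q) (h₁ : ι q ∈ T†.domain) (h₂ : ι q ∈ S.domain),
      ‖q‖ ≤ M * (‖ι q‖ + ‖T† ⟨ι q, h₁⟩‖ + ‖S ⟨ι q, h₂⟩‖)) :
    FiniteDimensional 𝕜 ↥((LinearMap.ker S.toFun).map S.domain.subtype ⊓ (LinearMap.ker T†.toFun).map T†.domain.subtype) :=
  finiteDimensional_harmonic_of_seqCompact hdT hcS (seqCompact_of_isCompactOperator ι hι hιsurj hιnorm)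

omit [CompleteSpace F] [CompleteSpace G] in
/-- **The compactness property gives the basic estimate (1.1.4).** [cite: Hormander1965, §1.1 Thm 1.1.3;
ArnoldFalkWinther2010, §3.1] -/
theorem exists_basic_estimate_of_isCompactOperator (hdT : Dense (T.domain : Set E)) (hcS : S.IsClosed)
    (ι : Q →L[𝕜] F) (hι : IsCompactOperator ι)
    (hιsurj : ∀ g : F, g ∈ T†.domain → g ∈ S.domain → ∃ q : Q, ι q = g) {M : ℝ}
    (hιnorm : ∀ (q : Q) (h₁ : ι q ∈ T†.domain) (h₂ : ι q ∈ S.domain),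
      ‖q‖ ≤ M * (‖ι q‖ + ‖T† ⟨ι q, h₁⟩‖ + ‖S ⟨ι q, h₂⟩‖)) :
    ∃ C : ℝ, 0 ≤ C ∧ ∀ (g : F) (hgT : g ∈ T†.domain) (hgS : g ∈ S.domain),
      g ∈ ((LinearMap.ker S.toFun).map S.domain.subtype ⊓ (LinearMap.ker T†.toFun).map T†.domain.subtype)ᗮ → ‖g‖ ^ 2 ≤ C ^ 2 * (‖T† ⟨g, hgT⟩‖ ^ 2 + ‖S ⟨g, hgS⟩‖ ^ 2) :=
  exists_basic_estimate_of_seqCompact hdT hcS (seqCompact_of_isCompactOperator ι hι hιsurj hιnorm)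

/-- **"compactness property ⟹ Fredholm ⟹ closed": `Im T` and `Im S` are closed.**
[cite: ArnoldFalkWinther2010, §3.1; Hormander1965, §1.1 Thms 1.1.2–1.1.3] -/
theorem isClosed_range_of_isCompactOperator (hdT : Dense (T.domain : Set E)) (hcT : T.IsClosed)
    (hdS : Dense (S.domain : Set F)) (hcS : S.IsClosed)
    (hST : LinearMap.range T.toFun ≤ (LinearMap.ker S.toFun).map S.domain.subtype)
    (ι : Q →L[𝕜] F) (hι : IsCompactOperator ι)
    (hιsurj : ∀ g : F, g ∈ T†.domain → g ∈ S.domain → ∃ q : Q, ι q = g) {M : ℝ}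
    (hιnorm : ∀ (q : Q) (h₁ : ι q ∈ T†.domain) (h₂ : ι q ∈ S.domain),
      ‖q‖ ≤ M * (‖ι q‖ + ‖T† ⟨ι q, h₁⟩‖ + ‖S ⟨ι q, h₂⟩‖)) :
    IsClosed ((LinearMap.range T.toFun : Submodule 𝕜 F) : Set F) ∧
      IsClosed ((LinearMap.range S.toFun : Submodule 𝕜 G) : Set G) :=
  isClosed_range_of_seqCompact hdT hcT hdS hcS hST (seqCompact_of_isCompactOperator ι hι hιsurj hιnorm)

/-- **Under the compactness property `Im □` is closed.** [cite: ArnoldFalkWinther2010, §3.1; BruningLesch1992,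
§2 Thm 2.4 (proof, (2.17))] -/
theorem isClosed_range_laplacian_of_isCompactOperator (hdT : Dense (T.domain : Set E)) (hcT : T.IsClosed)
    (hdS : Dense (S.domain : Set F)) (hcS : S.IsClosed)
    (hST : LinearMap.range T.toFun ≤ (LinearMap.ker S.toFun).map S.domain.subtype)
    (hdom : ∀ x : F, x ∈ L.domain ↔ (∃ hxT : x ∈ T†.domain, T† ⟨x, hxT⟩ ∈ T.domain) ∧
      (∃ hxS : x ∈ S.domain, S ⟨x, hxS⟩ ∈ S†.domain))
    (hval : ∀ (x : L.domain) (hxT : (x : F) ∈ T†.domain) (hTx : T† ⟨x, hxT⟩ ∈ T.domain)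
      (hxS : (x : F) ∈ S.domain) (hSx : S ⟨x, hxS⟩ ∈ S†.domain),
      L x = T ⟨T† ⟨x, hxT⟩, hTx⟩ + S† ⟨S ⟨x, hxS⟩, hSx⟩)
    (ι : Q →L[𝕜] F) (hι : IsCompactOperator ι)
    (hιsurj : ∀ g : F, g ∈ T†.domain → g ∈ S.domain → ∃ q : Q, ι q = g) {M : ℝ}
    (hιnorm : ∀ (q : Q) (h₁ : ι q ∈ T†.domain) (h₂ : ι q ∈ S.domain),
      ‖q‖ ≤ M * (‖ι q‖ + ‖T† ⟨ι q, h₁⟩‖ + ‖S ⟨ι q, h₂⟩‖)) :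
    IsClosed ((LinearMap.range L.toFun : Submodule 𝕜 F) : Set F) := by
  obtain ⟨C, -, h14⟩ := exists_basic_estimate_of_isCompactOperator hdT hcS ι hι hιsurj hιnorm
  exact isClosed_range_laplacian_of_basic_estimate hdT hcT hdS hcS hST hdom hval h14

omit [CompleteSpace G] in
/-- **Under the compactness property `□` has a gap on `𝔥^⊥`**: `‖u‖ ≤ c‖□u‖` for `u ∈ D_□ ∩ 𝔥^⊥`.
[cite: Hormander1965, §1.1 Thm 1.1.3 with (1.1.4); BruningLesch1992, §2 ("discrete" complexes, (2.51)ff)] -/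
theorem exists_gap_of_isCompactOperator (hdT : Dense (T.domain : Set E)) (hdS : Dense (S.domain : Set F))
    (hcS : S.IsClosed)
    (hdom : ∀ x : F, x ∈ L.domain ↔ (∃ hxT : x ∈ T†.domain, T† ⟨x, hxT⟩ ∈ T.domain) ∧
      (∃ hxS : x ∈ S.domain, S ⟨x, hxS⟩ ∈ S†.domain))
    (hval : ∀ (x : L.domain) (hxT : (x : F) ∈ T†.domain) (hTx : T† ⟨x, hxT⟩ ∈ T.domain)
      (hxS : (x : F) ∈ S.domain) (hSx : S ⟨x, hxS⟩ ∈ S†.domain),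
      L x = T ⟨T† ⟨x, hxT⟩, hTx⟩ + S† ⟨S ⟨x, hxS⟩, hSx⟩)
    (ι : Q →L[𝕜] F) (hι : IsCompactOperator ι)
    (hιsurj : ∀ g : F, g ∈ T†.domain → g ∈ S.domain → ∃ q : Q, ι q = g) {M : ℝ}
    (hιnorm : ∀ (q : Q) (h₁ : ι q ∈ T†.domain) (h₂ : ι q ∈ S.domain),
      ‖q‖ ≤ M * (‖ι q‖ + ‖T† ⟨ι q, h₁⟩‖ + ‖S ⟨ι q, h₂⟩‖)) :
    ∃ c : ℝ, 0 ≤ c ∧ ∀ u : L.domain, (u : F) ∈ ((LinearMap.ker S.toFun).map S.domain.subtype ⊓ (LinearMap.ker T†.toFun).map T†.domain.subtype)ᗮ → ‖(u : F)‖ ≤ c * ‖L u‖ := by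
  obtain ⟨C, -, h14⟩ := exists_basic_estimate_of_isCompactOperator hdT hcS ι hι hιsurj hιnorm
  exact ⟨C ^ 2, sq_nonneg C, norm_le_of_basic_estimate hdT hdS hdom hval h14⟩

/-- **The strong Hodge decomposition `H₂ = 𝔥 ⊕ Im T ⊕ Im S*` under the compactness property** ("Fredholm ⟹
closed" and (1.1.5) with closed ranges). [cite: ArnoldFalkWinther2010, §3.1; BruningLesch1992, §2 Cor. 2.5 (2.17)] -/
theorem harmonic_sup_range_sup_range_adjoint_eq_top_of_isCompactOperator (hdT : Dense (T.domain : Set E))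
    (hcT : T.IsClosed) (hdS : Dense (S.domain : Set F)) (hcS : S.IsClosed)
    (hST : LinearMap.range T.toFun ≤ (LinearMap.ker S.toFun).map S.domain.subtype)
    (ι : Q →L[𝕜] F) (hι : IsCompactOperator ι)
    (hιsurj : ∀ g : F, g ∈ T†.domain → g ∈ S.domain → ∃ q : Q, ι q = g) {M : ℝ}
    (hιnorm : ∀ (q : Q) (h₁ : ι q ∈ T†.domain) (h₂ : ι q ∈ S.domain),
      ‖q‖ ≤ M * (‖ι q‖ + ‖T† ⟨ι q, h₁⟩‖ + ‖S ⟨ι q, h₂⟩‖)) :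
    ((LinearMap.ker S.toFun).map S.domain.subtype ⊓ (LinearMap.ker T†.toFun).map T†.domain.subtype) ⊔ LinearMap.range T.toFun ⊔ LinearMap.range S†.toFun = ⊤ := by
  obtain ⟨C, -, h14⟩ := exists_basic_estimate_of_isCompactOperator hdT hcS ι hι hιsurj hιnorm
  exact harmonic_sup_range_sup_range_adjoint_eq_top_of_basic_estimate hdT hcT hdS hcS hST h14

omit [CompleteSpace G] in
/-- **Under the compactness property a Green operator `K` is compact** ("`K` maps `W^k` boundedly into
`V^k ∩ V*_k` … Hence `K` is a compact operator … compact as an operator from `W^k` to itself": `Kf = ιq_f` with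
`‖q_f‖_Q ≤ M(‖Kf‖ + ‖T*Kf‖ + ‖SKf‖) ≤ M(C² + 2|C|)‖f‖`). [cite: ArnoldFalkWinther2010, §3.5] -/
theorem isCompactOperator_green (hdT : Dense (T.domain : Set E)) (hdS : Dense (S.domain : Set F))
    (hcS : S.IsClosed)
    (hdom : ∀ x : F, x ∈ L.domain ↔ (∃ hxT : x ∈ T†.domain, T† ⟨x, hxT⟩ ∈ T.domain) ∧
      (∃ hxS : x ∈ S.domain, S ⟨x, hxS⟩ ∈ S†.domain))
    (hval : ∀ (x : L.domain) (hxT : (x : F) ∈ T†.domain) (hTx : T† ⟨x, hxT⟩ ∈ T.domain)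
      (hxS : (x : F) ∈ S.domain) (hSx : S ⟨x, hxS⟩ ∈ S†.domain),
      L x = T ⟨T† ⟨x, hxT⟩, hTx⟩ + S† ⟨S ⟨x, hxS⟩, hSx⟩)
    (hK : ∀ f : F, ∃ h : K f ∈ L.domain,
      K f ∈ ((LinearMap.ker S.toFun).map S.domain.subtype ⊓ (LinearMap.ker T†.toFun).map T†.domain.subtype)ᗮ ∧
      f - L ⟨K f, h⟩ ∈ (LinearMap.ker S.toFun).map S.domain.subtype ⊓
        (LinearMap.ker T†.toFun).map T†.domain.subtype)
    (ι : Q →L[𝕜] F) (hι : IsCompactOperator ι)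
    (hιsurj : ∀ g : F, g ∈ T†.domain → g ∈ S.domain → ∃ q : Q, ι q = g) {M : ℝ}
    (hιnorm : ∀ (q : Q) (h₁ : ι q ∈ T†.domain) (h₂ : ι q ∈ S.domain),
      ‖q‖ ≤ M * (‖ι q‖ + ‖T† ⟨ι q, h₁⟩‖ + ‖S ⟨ι q, h₂⟩‖)) :
    IsCompactOperator K := by
  obtain ⟨C, -, h14⟩ := exists_basic_estimate_of_isCompactOperator hdT hcS ι hι hιsurj hιnorm
  set R : ℝ := max M 0 * (C ^ 2 * 1 + |C| * 1 + |C| * 1) with hR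
  have key : (K : F → F) '' Metric.ball 0 1 ⊆ closure ((ι : Q → F) '' Metric.closedBall 0 R) := by
    rintro y ⟨f, hf, rfl⟩
    have hf1 : ‖f‖ ≤ 1 := (mem_ball_zero_iff.1 hf).le
    obtain ⟨h, -, -⟩ := hK f
    have hxT : K f ∈ T†.domain := laplacian_domain_le_adjoint_domain hdom h
    have hxS : K f ∈ S.domain := laplacian_domain_le_domain hdom h
    obtain ⟨q, hq⟩ := hιsurj (K f) hxT hxS
    refine subset_closure ⟨q, ?_, hq⟩
    rw [mem_closedBall_zero_iff]
    have h₁ : ι q ∈ T†.domain := by rw [hq]; exact hxT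
    have h₂ : ι q ∈ S.domain := by rw [hq]; exact hxS
    refine norm_le_of_graph_bound hιnorm h₁ h₂ ?_ ?_ ?_
    · rw [hq]
      exact (norm_green_le_of_basic_estimate hdT hdS hdom hval hK h14 f).trans
        (mul_le_mul_of_nonneg_left hf1 (sq_nonneg C))
    · have e : T† ⟨ι q, h₁⟩ = T† ⟨K f, hxT⟩ := by congr 1; exact Subtype.ext hq
      rw [e]
      exact (norm_adjoint_green_le_of_basic_estimate hdT hdS hdom hval hK h14 f hxT).trans
        (mul_le_mul_of_nonneg_left hf1 (abs_nonneg C))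
    · have e : S ⟨ι q, h₂⟩ = S ⟨K f, hxS⟩ := by congr 1; exact Subtype.ext hq
      rw [e]
      exact (norm_apply_green_le_of_basic_estimate hdT hdS hdom hval hK h14 f hxS).trans
        (mul_le_mul_of_nonneg_left hf1 (abs_nonneg C))
  exact (isCompactOperator_iff_image_ball_subset_compact (K : F →ₗ[𝕜] F) zero_lt_one).2
    ⟨_, hι.isCompact_closure_image_closedBall (f := (ι : Q →ₗ[𝕜] F)) R, key⟩

end Literature.Analysis.InnerProduct
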